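import Summits.Ventures.CertifiedManyBodySolver.Downfold.EmeryShapeTrueCornerRule
import Summits.Ventures.CertifiedManyBodySolver.Downfold.EmeryFermiScalePointsTl2223OPK15TrueCorners
import Summits.Ventures.CertifiedManyBodySolver.Downfold.EmeryFermiScalePointsTl2223OPK15VirtualCorners
import HarnessLib

/-!
# THE ONE-BAND FERMI-SURFACE SHAPE `t′/t` OF THE WHOLE TYPED 3BE BOX `emeryBoxTl2223OPK15Src (EmeryBoxesKSlicesS)` AT ITS TWO TRUE CORNERS (true-corner rule under certified margins, §B.87 (i);
# router/EMERY-SHAPE-CORNERS.tsv «true» rows)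

Venture CertifiedManyBodySolver, cell `pub/hubbard-downfold` (stage S1; INFLATION-RULES-3to1-B §B.87 (i)), seat hubbard-downfold-mod-4 (technique B, g35); namespace
`Summit.Ventures.CertifiedManyBodySolver.Downfold.Emery`. Everything PROVED (0 sorry). WHAT THIS IS NOT: a statement about Tl₂Ba₂Ca₂Cu₃O₁₀ OUTER plane ((K) source box) — the typed box is SCREENING-GRADE; `U = 0`
one-body kinematics of the σ model; object E = the EXACT `t–t′` shape of the σ Fermi surface at the row's own Fermi energy.

For EVERY one-body row of `[1.62, 2.39] × [1.18, 1.39] × [0.61, 0.72] × [0.15, 0.18]` eV the one-band `t′/t` lies between its values at the TRUE corners `(Δ₁, a₁, b₂, c₂)` and `(Δ₂, a₂, b₁, c₁)`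
(`EmeryShapeTrueCornerRule`; the t_pp / t_pp′ directions by the MARGIN LEVERS of `EmeryMarginLevers`, margins certified by `norm_num` with the constants `M` printed below), read
over their K = 384 brackets (`EmeryFermiScalePointsTl2223OPK15TrueCorners`).

| filling | **true-corner window (certified)** | margins (t_pp lower/upper; t_pp′ lower/upper) | two-ray (§B.86 (i)) | g19 sub-box device |
|---|---|---|---|---|
| n_H = 1.14 (ν = 43/100) | **[-0.3244, -0.2534]** | M_b 0.4615 / 2.2612; M_c 0.0615 / 0.0 | see EmeryBoxesTl2223OPK15ShapeCorners | [-0.3265,-0.2512] (n_H band) |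
| n_H = 1.18 (ν = 41/100) | **[-0.3244, -0.2536]** | M_b 0.4979 / 2.2997; M_c 0.0103 / 0.0 | see EmeryBoxesTl2223OPK15ShapeCorners | [-0.3265,-0.2512] (n_H band) |

Sources: three-band model [HybertsenSchluterChristensen1989, Eq. (1)]; [AndersenEtAl1995, §6]; box rows as cited in the typed object's file.
-/

noncomputable section

namespace Summit.Ventures.CertifiedManyBodySolver.Downfold.Emery

open Real Set

/-- **n_H = 1.14 (ν = 43/100): for every row of the box the one-band Fermi-surface `t′/t` (object E) lies in `[-0.3244, -0.2534]` — its values at the two TRUE corners** (margin levers; margins by `norm_num`). [folklore] -/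
theorem tl2223OPK15Box_fsRatio_true_nH114 {Δ a b c : ℝ} (hΔ : Δ ∈ Icc ((81 : ℝ) / 50) ((239 : ℝ) / 100)) (ha : a ∈ Icc ((59 : ℝ) / 50) ((139 : ℝ) / 100)) (hb : b ∈ Icc ((61 : ℝ) / 100) ((18 : ℝ) / 25)) (hc : c ∈ Icc ((3 : ℝ) / 20) ((9 : ℝ) / 50)) :
    fsRatio Δ a b c (fermiEnergyOf Δ a b c ((43 : ℝ) / 100)) ∈ Icc ((-811 : ℝ) / 2500) ((-1267 : ℝ) / 5000) := by
  have hSL := (fermiEnergyOf_of_pointBracketCheck truePt_Tl2223OPK15SL_nH114_br (by norm_num) (by norm_num) (by norm_num) (ν := (43/100 : ℝ)) (by push_cast; exact ⟨le_rfl, le_rfl⟩)).2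
  have hTL := (fermiEnergyOf_of_pointBracketCheck truePt_Tl2223OPK15TL_nH114_br (by norm_num) (by norm_num) (by norm_num) (ν := (43/100 : ℝ)) (by push_cast; exact ⟨le_rfl, le_rfl⟩)).2
  have hSU := (fermiEnergyOf_of_pointBracketCheck truePt_Tl2223OPK15SU_nH114_br (by norm_num) (by norm_num) (by norm_num) (ν := (43/100 : ℝ)) (by push_cast; exact ⟨le_rfl, le_rfl⟩)).2
  have hQU := (fermiEnergyOf_of_pointBracketCheck truePt_Tl2223OPK15QU_nH114_br (by norm_num) (by norm_num) (by norm_num) (ν := (43/100 : ℝ)) (by push_cast; exact ⟨le_rfl, le_rfl⟩)).2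
  have hTH := (fermiEnergyOf_of_pointBracketCheck truePt_Tl2223OPK15TH_nH114_br (by norm_num) (by norm_num) (by norm_num) (ν := (43/100 : ℝ)) (by push_cast; exact ⟨le_rfl, le_rfl⟩)).2
  have hAlo := (fermiEnergyOf_of_pointBracketCheck virtPt_Tl2223OPK15Alo_nH114_br (by norm_num) (by norm_num) (by norm_num) (ν := (43/100 : ℝ)) (by push_cast; exact ⟨le_rfl, le_rfl⟩)).2
  have hTop := (fermiEnergyOf_of_pointBracketCheck virtPt_Tl2223OPK15H_nH114_br (by norm_num) (by norm_num) (by norm_num) (ν := (43/100 : ℝ)) (by push_cast; exact ⟨le_rfl, le_rfl⟩)).2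
  push_cast at hSL hTL hSU hQU hTH hAlo hTop
  norm_num at hSL hTL hSU hQU hTH hAlo hTop
  obtain ⟨hΔl, hΔu⟩ := hΔ
  obtain ⟨hal, hau⟩ := ha
  constructor
  · have hlow := fsRatio_fermiEnergyOf_trueCorner_lower (Δ₁ := ((81 : ℝ) / 50)) (a₁ := ((59 : ℝ) / 50)) (b₁ := ((61 : ℝ) / 100)) (b₂ := ((18 : ℝ) / 25)) (c₁ := ((3 : ℝ) / 20)) (c₂ := ((9 : ℝ) / 50))
      (ν := ((43 : ℝ) / 100)) (pL := ((15723 : ℝ) / 10000)) (qL := ((16477 : ℝ) / 10000)) (Mb := ((923 : ℝ) / 2000)) (Mc := ((123 : ℝ) / 2000)) (by norm_num) hΔl (by norm_num) hal (by norm_num) hb (by norm_num) hc (by norm_num) (by norm_num) (by norm_num)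
      (by norm_num) hSL.1 hAlo.2 (by norm_num) (by norm_num [fsD, fsN]) (by norm_num) (by norm_num) (by norm_num [fsD, fsN]) (by norm_num) (by norm_num [dopingDisc]) (by norm_num [fsD, fsN])
    refine le_trans ?_ hlow
    have hw := (fsRatio_mem_Icc_on_window_of_dopingDisc_nonneg (Δ := ((81 : ℝ) / 50)) (a := ((59 : ℝ) / 50)) (b := ((18 : ℝ) / 25)) (c := ((9 : ℝ) / 50))
      (p := ((16063 : ℝ) / 10000)) (q := ((16213 : ℝ) / 10000)) (by norm_num) (by norm_num) (by norm_num) (by norm_num) (by norm_num) (by norm_num) (by norm_num) (by norm_num [dopingDisc]) hTL).1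
    refine le_trans ?_ hw
    norm_num [fsRatio, fsD, fsN]
  · have hup := fsRatio_fermiEnergyOf_trueCorner_upper (Δ₁ := ((81 : ℝ) / 50)) (Δ₂ := ((239 : ℝ) / 100)) (a₁ := ((59 : ℝ) / 50)) (a₂ := ((139 : ℝ) / 100)) (b₁ := ((61 : ℝ) / 100)) (b₂ := ((18 : ℝ) / 25)) (c₁ := ((3 : ℝ) / 20)) (c₂ := ((9 : ℝ) / 50))
      (ν := ((43 : ℝ) / 100)) (pU := ((16979 : ℝ) / 10000)) (qU := ((17633 : ℝ) / 10000)) (qT := ((4053 : ℝ) / 2000)) (Mb := ((5653 : ℝ) / 2500)) (Mc := (0 : ℝ)) (by norm_num) ⟨hΔl, hΔu⟩ (by norm_num) ⟨hal, hau⟩ (by norm_num) hb (by norm_num) hc (by norm_num) (by norm_num) (by norm_num)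
      hTop.2 (by norm_num) (by norm_num) hSU.1 hQU.2 (by norm_num) (by norm_num [fsD, fsN]) (by norm_num) (by norm_num) (by norm_num [fsD, fsN]) (by norm_num) (by norm_num) (by norm_num [fsD, fsN])
    refine le_trans hup ?_
    have hw := (fsRatio_mem_Icc_on_window_of_dopingDisc_nonpos (Δ := ((239 : ℝ) / 100)) (a := ((139 : ℝ) / 100)) (b := ((61 : ℝ) / 100)) (c := ((3 : ℝ) / 20))
      (p := ((17223 : ℝ) / 10000)) (q := ((17323 : ℝ) / 10000)) (by norm_num) (by norm_num) (by norm_num) (by norm_num) (by norm_num) (by norm_num) (by norm_num) (by norm_num [dopingDisc]) hTH).2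
    refine le_trans hw ?_
    norm_num [fsRatio, fsD, fsN]

/-- **n_H = 1.18 (ν = 41/100): for every row of the box the one-band Fermi-surface `t′/t` (object E) lies in `[-0.3244, -0.2536]` — its values at the two TRUE corners** (margin levers; margins by `norm_num`). [folklore] -/
theorem tl2223OPK15Box_fsRatio_true_nH118 {Δ a b c : ℝ} (hΔ : Δ ∈ Icc ((81 : ℝ) / 50) ((239 : ℝ) / 100)) (ha : a ∈ Icc ((59 : ℝ) / 50) ((139 : ℝ) / 100)) (hb : b ∈ Icc ((61 : ℝ) / 100) ((18 : ℝ) / 25)) (hc : c ∈ Icc ((3 : ℝ) / 20) ((9 : ℝ) / 50)) :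
    fsRatio Δ a b c (fermiEnergyOf Δ a b c ((41 : ℝ) / 100)) ∈ Icc ((-811 : ℝ) / 2500) ((-317 : ℝ) / 1250) := by
  have hSL := (fermiEnergyOf_of_pointBracketCheck truePt_Tl2223OPK15SL_nH118_br (by norm_num) (by norm_num) (by norm_num) (ν := (41/100 : ℝ)) (by push_cast; exact ⟨le_rfl, le_rfl⟩)).2
  have hTL := (fermiEnergyOf_of_pointBracketCheck truePt_Tl2223OPK15TL_nH118_br (by norm_num) (by norm_num) (by norm_num) (ν := (41/100 : ℝ)) (by push_cast; exact ⟨le_rfl, le_rfl⟩)).2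
  have hSU := (fermiEnergyOf_of_pointBracketCheck truePt_Tl2223OPK15SU_nH118_br (by norm_num) (by norm_num) (by norm_num) (ν := (41/100 : ℝ)) (by push_cast; exact ⟨le_rfl, le_rfl⟩)).2
  have hQU := (fermiEnergyOf_of_pointBracketCheck truePt_Tl2223OPK15QU_nH118_br (by norm_num) (by norm_num) (by norm_num) (ν := (41/100 : ℝ)) (by push_cast; exact ⟨le_rfl, le_rfl⟩)).2
  have hTH := (fermiEnergyOf_of_pointBracketCheck truePt_Tl2223OPK15TH_nH118_br (by norm_num) (by norm_num) (by norm_num) (ν := (41/100 : ℝ)) (by push_cast; exact ⟨le_rfl, le_rfl⟩)).2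
  have hAlo := (fermiEnergyOf_of_pointBracketCheck virtPt_Tl2223OPK15Alo_nH118_br (by norm_num) (by norm_num) (by norm_num) (ν := (41/100 : ℝ)) (by push_cast; exact ⟨le_rfl, le_rfl⟩)).2
  have hTop := (fermiEnergyOf_of_pointBracketCheck virtPt_Tl2223OPK15H_nH118_br (by norm_num) (by norm_num) (by norm_num) (ν := (41/100 : ℝ)) (by push_cast; exact ⟨le_rfl, le_rfl⟩)).2
  push_cast at hSL hTL hSU hQU hTH hAlo hTop
  norm_num at hSL hTL hSU hQU hTH hAlo hTop
  obtain ⟨hΔl, hΔu⟩ := hΔ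
  obtain ⟨hal, hau⟩ := ha
  constructor
  · have hlow := fsRatio_fermiEnergyOf_trueCorner_lower (Δ₁ := ((81 : ℝ) / 50)) (a₁ := ((59 : ℝ) / 50)) (b₁ := ((61 : ℝ) / 100)) (b₂ := ((18 : ℝ) / 25)) (c₁ := ((3 : ℝ) / 20)) (c₂ := ((9 : ℝ) / 50))
      (ν := ((41 : ℝ) / 100)) (pL := ((15341 : ℝ) / 10000)) (qL := ((3209 : ℝ) / 2000)) (Mb := ((4979 : ℝ) / 10000)) (Mc := ((103 : ℝ) / 10000)) (by norm_num) hΔl (by norm_num) hal (by norm_num) hb (by norm_num) hc (by norm_num) (by norm_num) (by norm_num)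
      (by norm_num) hSL.1 hAlo.2 (by norm_num) (by norm_num [fsD, fsN]) (by norm_num) (by norm_num) (by norm_num [fsD, fsN]) (by norm_num) (by norm_num [dopingDisc]) (by norm_num [fsD, fsN])
    refine le_trans ?_ hlow
    have hw := (fsRatio_mem_Icc_on_window_of_dopingDisc_nonpos (Δ := ((81 : ℝ) / 50)) (a := ((59 : ℝ) / 50)) (b := ((18 : ℝ) / 25)) (c := ((9 : ℝ) / 50))
      (p := ((977 : ℝ) / 625)) (q := ((7891 : ℝ) / 5000)) (by norm_num) (by norm_num) (by norm_num) (by norm_num) (by norm_num) (by norm_num) (by norm_num) (by norm_num [dopingDisc]) hTL).1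
    refine le_trans ?_ hw
    norm_num [fsRatio, fsD, fsN]
  · have hup := fsRatio_fermiEnergyOf_trueCorner_upper (Δ₁ := ((81 : ℝ) / 50)) (Δ₂ := ((239 : ℝ) / 100)) (a₁ := ((59 : ℝ) / 50)) (a₂ := ((139 : ℝ) / 100)) (b₁ := ((61 : ℝ) / 100)) (b₂ := ((18 : ℝ) / 25)) (c₁ := ((3 : ℝ) / 20)) (c₂ := ((9 : ℝ) / 50))
      (ν := ((41 : ℝ) / 100)) (pU := ((16613 : ℝ) / 10000)) (qU := ((8599 : ℝ) / 5000)) (qT := ((3957 : ℝ) / 2000)) (Mb := ((22997 : ℝ) / 10000)) (Mc := (0 : ℝ)) (by norm_num) ⟨hΔl, hΔu⟩ (by norm_num) ⟨hal, hau⟩ (by norm_num) hb (by norm_num) hc (by norm_num) (by norm_num) (by norm_num)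
      hTop.2 (by norm_num) (by norm_num) hSU.1 hQU.2 (by norm_num) (by norm_num [fsD, fsN]) (by norm_num) (by norm_num) (by norm_num [fsD, fsN]) (by norm_num) (by norm_num) (by norm_num [fsD, fsN])
    refine le_trans hup ?_
    have hw := (fsRatio_mem_Icc_on_window_of_dopingDisc_nonpos (Δ := ((239 : ℝ) / 100)) (a := ((139 : ℝ) / 100)) (b := ((61 : ℝ) / 100)) (c := ((3 : ℝ) / 20))
      (p := ((3373 : ℝ) / 2000)) (q := ((3393 : ℝ) / 2000)) (by norm_num) (by norm_num) (by norm_num) (by norm_num) (by norm_num) (by norm_num) (by norm_num) (by norm_num [dopingDisc]) hTH).2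
    refine le_trans hw ?_
    norm_num [fsRatio, fsD, fsN]

end Summit.Ventures.CertifiedManyBodySolver.Downfold.Emery
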